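import Literature.Computability.AlgebraicComplexity.BD17GaleMinorsProofs
import Literature.Computability.AlgebraicComplexity.BD17SignatureBoundProofs
import Literature.Computability.AlgebraicComplexity.BD17DescartesSystemsWronskians
import Mathlib.LinearAlgebra.Vandermonde
import Mathlib.Analysis.Calculus.IteratedDeriv.Defs
import Mathlib.Analysis.Calculus.Deriv.Inv
import Mathlib.Analysis.Analytic.Constructions
import Mathlib.Topology.Order.IntermediateValue
import HarnessLib

/-!
# Bihan–Dickenstein 2017, Prop. 4.3 from Prop. 4.2: the Wronskians of the reciprocal Gale-dual
# linear functions `1/p_{ᾱ_0}, …, 1/p_{ᾱ_{k−1}}` — PROVED REDUCTION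

F. Bihan, A. Dickenstein, *Descartes' rule of signs for polynomial systems supported on circuits*,
Int. Math. Res. Not. IMRN 2017 (22) 6867–6893 = arXiv:1601.05826 [BihanDickenstein2017], §4.1
(held text `paper:arxiv-1601.05826`, p0010:L79–L100 = flat "Proposition 20" = Prop. 4.3 and its
proof; concordance `pub/val-lit/lit/CONCORDANCE-printed.md § BD17`). THEOREMS ONLY; sibling of the
statement file `BD17DescartesSystemsWronskians.lean` (cell `val-lit`, row X4-BD17), whose named
facts `BD2017_prop_4_2` ([P-S] Pólya–Szegő, the Wronskian criterion for Descartes' rule) and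
`BD2017_prop_4_3` are NOT restated: this file proves the edge

* `BD2017_prop_4_3_of_prop_4_2 : BD2017_prop_4_2 → BD2017_prop_4_3`,

so that in §4 of the paper only the external criterion Prop. 4.2 remains a named fact.

The printed proof (p0010:L83–L100) is followed step by step:

* "`(1/p_j)^{(i−1)} = (−1)^{i−1} (i−1)! · P_{j,2}^{i−1}/p_j^i`" — `BD17.iteratedDeriv_one_div_affine`
  (induction, differentiating the closed formula near the point, `Filter.EventuallyEq.deriv_eq`);
* "by the computation of a Vandermonde determinant … `W(1/p_1, …, 1/p_ℓ) = γ_ℓ · (p_1⋯p_ℓ)^{-1} ·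
  ∏_{r_1<r_2} (P_{r_2,2}/p_{r_2} − P_{r_1,2}/p_{r_1})`" and "`P_{i,2}/p_i − P_{j,2}/p_j =
  det(P_j, P_i)/(p_i p_j)`" — `BD17.wronskian_one_div_galeLin` (Mathlib's `Matrix.det_vandermonde`,
  `det_mul_row/column`), arranged as (signed constant depending only on `ℓ`) × (positive function)
  (`BD17.wronskian_const_ne_zero`, `BD17.wronskian_factor_pos`);
* "`det(P_{ᾱ_j}, P_{ᾱ_i}) > 0` on `Δ_P` (or `< 0`) for any `j < i`" — `BD17.galeDet_restrictOrdering_sign`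
  (the ordering gives `≥ 0`; nonvanishing on `K` by the minors identity (2.11) of
  `BD17GaleMinorsProofs` and `det C(ᾱ_i, ᾱ_j) ≠ 0`);
* the setting of Def. 4.1 / Prop. 4.2: `Δ_P` is open (`BD17.isOpen_galeInterval`) and an interval
  (`BD17.ordConnected_galeInterval`, hence connected when nonempty), and the `1/p_j` are analytic
  on it (`BD17.analyticOnNhd_one_div_galeLin`).

Honest framing: a typed-literature companion (LADDER-VALIANT V1 ideation source); nothing here bears
on VP versus VNP.

## References

* [BihanDickenstein2017] F. Bihan, A. Dickenstein, IMRN 2017 (22) 6867–6893; arXiv:1601.05826,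
  §2.3, Rem. 2.4, §4.1 Def. 4.1, Prop. 4.2, Prop. 4.3.
* G. Pólya, G. Szegő, *Problems and theorems in analysis II*, Part V items 87, 90 (Prop. 4.2, the
  hypothesis of the edge; cited in print, not formalised).
-/

noncomputable section

open Matrix Finset

namespace Literature.Computability.AlgebraicComplexity

namespace BD17

variable {n : ℕ}

/-! ### Iterated derivatives of `y ↦ 1/(a + b y)` -/

/-- `(1/p)^{(i)} = (−1)^i i! · b^i / p^{i+1}` for `p(y) = a + b y ≠ 0` ("`(1/p_j)^{(i−1)} =
(−1)^{i−1} (i−1)! · P_{j,2}^{i−1} / p_j^i`", p0010:L90). [cite: BihanDickenstein2017, Prop. 4.3 (proof)] -/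
theorem iteratedDeriv_one_div_affine (a b : ℝ) (i : ℕ) {y : ℝ} (hy : a + b * y ≠ 0) :
    iteratedDeriv i (fun y => 1 / (a + b * y)) y =
      (-1) ^ i * (i.factorial : ℝ) * b ^ i / (a + b * y) ^ (i + 1) := by
  induction i generalizing y with
  | zero => simp
  | succ i ih =>
    rw [iteratedDeriv_succ]
    -- near `y` the `i`-th derivative is the closed formula
    have hopen : IsOpen {z : ℝ | a + b * z ≠ 0} :=
      isOpen_ne_fun (continuous_const.add (continuous_const.mul continuous_id)) continuous_const
    have hev : iteratedDeriv i (fun y => 1 / (a + b * y)) =ᶠ[nhds y]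
        fun z => (-1) ^ i * (i.factorial : ℝ) * b ^ i / (a + b * z) ^ (i + 1) := by
      filter_upwards [hopen.mem_nhds hy] with z hz
      exact ih hz
    rw [hev.deriv_eq]
    -- differentiate the closed formula
    have hp : HasDerivAt (fun z => (a + b * z) ^ (i + 1)) (((i + 1 : ℕ) : ℝ) * (a + b * y) ^ i * b) y := by
      have h1 : HasDerivAt (fun z => a + b * z) b y := by
        simpa using ((hasDerivAt_id y).const_mul b).const_add a
      exact h1.pow (i + 1)
    have hinv := hp.inv (pow_ne_zero _ hy)
    have hc := hinv.const_mul ((-1) ^ i * (i.factorial : ℝ) * b ^ i)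
    have hF : HasDerivAt (fun z => (-1) ^ i * (i.factorial : ℝ) * b ^ i / (a + b * z) ^ (i + 1))
        ((-1) ^ i * (i.factorial : ℝ) * b ^ i *
          (-(((i + 1 : ℕ) : ℝ) * (a + b * y) ^ i * b) / ((a + b * y) ^ (i + 1)) ^ 2)) y :=
      hc.congr_of_eventuallyEq (Filter.Eventually.of_forall fun z => by
        simp only [Pi.inv_apply, div_eq_mul_inv])
    rw [hF.deriv, Nat.factorial_succ, Nat.cast_mul]
    field_simp
    ring

/-! ### The interval `Δ_P` -/

/-- `Δ_P` is open. [cite: BihanDickenstein2017, Rem. 2.4 eq. (2.9)] -/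
theorem isOpen_galeInterval (B : Matrix (Fin (n + 2)) (Fin 2) ℝ) : IsOpen (galeInterval B) := by
  have : galeInterval B = ⋂ j, {y : ℝ | 0 < B j 0 + B j 1 * y} := by
    ext y
    simp [galeInterval, galeLin]
  rw [this]
  exact isOpen_iInter_of_finite fun j =>
    isOpen_lt continuous_const (continuous_const.add (continuous_const.mul continuous_id))

/-- `Δ_P` is an interval (order-connected). [cite: BihanDickenstein2017, Rem. 2.4 eq. (2.9)] -/
theorem ordConnected_galeInterval (B : Matrix (Fin (n + 2)) (Fin 2) ℝ) :
    (galeInterval B).OrdConnected := by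
  refine ⟨fun y₁ hy₁ y₂ hy₂ y hy j => ?_⟩
  have h1 := hy₁ j
  have h2 := hy₂ j
  simp only [galeLin] at h1 h2 ⊢
  obtain ⟨hl, hr⟩ := hy
  rcases le_total 0 (B j 1) with hb | hb <;> nlinarith

/-- `1/p_j` is analytic on `Δ_P`. [cite: BihanDickenstein2017, Prop. 4.3] -/
theorem analyticOnNhd_one_div_galeLin (B : Matrix (Fin (n + 2)) (Fin 2) ℝ) (j : Fin (n + 2)) :
    AnalyticOnNhd ℝ (fun y => 1 / galeLin B j y) (galeInterval B) := by
  intro y hy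
  have hne : galeLin B j y ≠ 0 := (hy j).ne'
  have h : AnalyticAt ℝ (fun y => galeLin B j y) y := by
    simp only [galeLin]
    exact analyticAt_const.add (analyticAt_const.mul analyticAt_id)
  exact analyticAt_const.div h hne

/-! ### The Wronskian of `1/p_{v_0}, …, 1/p_{v_{ℓ−1}}`: a signed constant times a positive function -/

/-- **The Wronskian computation of Prop. 4.3** (p0010:L86–L100): by Vandermonde,
`W(1/p_{v_0}, …, 1/p_{v_{ℓ−1}}) = γ_ℓ · ∏_b p_{v_b}^{-1} · ∏_{i<j} (P_{v_j,2}/p_{v_j} − P_{v_i,2}/p_{v_i})`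
and `P_{j,2}/p_j − P_{i,2}/p_i = det(P_i, P_j)/(p_i p_j)`; here arranged as
`(γ_ℓ ∏_{i<j} ε) · (∏_b p_{v_b}^{-1} ∏_{i<j} ε det(P_{v_i}, P_{v_j})/(p_{v_i} p_{v_j}))` for a sign
`ε ∈ {1, −1}`. [cite: BihanDickenstein2017, Prop. 4.3 (proof)] -/
theorem wronskian_one_div_galeLin {ℓ : ℕ} (B : Matrix (Fin (n + 2)) (Fin 2) ℝ)
    (v : Fin ℓ → Fin (n + 2)) (ε : ℝ) (hε : ε = 1 ∨ ε = -1) {y : ℝ} (hy : y ∈ galeInterval B) :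
    wronskian (fun b => fun y => 1 / galeLin B (v b) y) y =
      ((∏ i : Fin ℓ, ((-1 : ℝ) ^ (i : ℕ) * ((i : ℕ).factorial : ℝ))) * ∏ i : Fin ℓ, ∏ _j ∈ Ioi i, ε) *
        ((∏ b, 1 / galeLin B (v b) y) *
          ∏ i : Fin ℓ, ∏ j ∈ Ioi i,
            ε * galeDet B (v i) (v j) / (galeLin B (v i) y * galeLin B (v j) y)) := by
  have hp : ∀ b, galeLin B (v b) y ≠ 0 := fun b => (hy (v b)).ne'
  have hp' : ∀ b, B (v b) 0 + B (v b) 1 * y ≠ 0 := fun b => by simpa [galeLin] using hp b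
  -- the entries of the Wronskian matrix
  have hentry : ∀ i b : Fin ℓ, iteratedDeriv i (fun y => 1 / galeLin B (v b) y) y =
      ((-1 : ℝ) ^ (i : ℕ) * ((i : ℕ).factorial : ℝ)) *
        ((1 / galeLin B (v b) y) * (B (v b) 1 / galeLin B (v b) y) ^ (i : ℕ)) := by
    intro i b
    have hfun : (fun y => 1 / galeLin B (v b) y) = fun y => 1 / (B (v b) 0 + B (v b) 1 * y) := by
      funext z
      rfl
    rw [hfun, iteratedDeriv_one_div_affine (B (v b) 0) (B (v b) 1) i (hp' b)]
    simp only [galeLin]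
    have h := hp' b
    rw [div_pow, pow_succ]
    field_simp
  unfold wronskian
  have hM : (Matrix.of fun i j : Fin ℓ =>
      iteratedDeriv i.val ((fun b => fun y => 1 / galeLin B (v b) y) j) y) =
      Matrix.of fun i j : Fin ℓ => ((-1 : ℝ) ^ (i : ℕ) * ((i : ℕ).factorial : ℝ)) *
        (Matrix.of fun i j : Fin ℓ => (1 / galeLin B (v j) y) *
          (Matrix.vandermonde (fun b => B (v b) 1 / galeLin B (v b) y))ᵀ i j) i j := by
    ext i j
    simp only [Matrix.of_apply, Matrix.transpose_apply, Matrix.vandermonde_apply]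
    exact hentry i j
  rw [hM, Matrix.det_mul_column, Matrix.det_mul_row, Matrix.det_transpose, Matrix.det_vandermonde]
  -- the differences of the Vandermonde nodes
  have hε2 : ε * ε = 1 := by rcases hε with rfl | rfl <;> norm_num
  have hdiff : ∀ i j : Fin ℓ, B (v j) 1 / galeLin B (v j) y - B (v i) 1 / galeLin B (v i) y =
      ε * (ε * galeDet B (v i) (v j) / (galeLin B (v i) y * galeLin B (v j) y)) := by
    intro i j
    rw [← mul_div_assoc, ← mul_assoc, hε2, one_mul, div_sub_div _ _ (hp j) (hp i)]
    congr 1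
    · simp only [galeLin, galeDet]
      ring
    · exact mul_comm _ _
  simp_rw [hdiff, Finset.prod_mul_distrib]
  ring

/-- The positive factor of the Wronskian. [cite: BihanDickenstein2017, Prop. 4.3 (proof)] -/
theorem wronskian_factor_pos {ℓ : ℕ} (B : Matrix (Fin (n + 2)) (Fin 2) ℝ) (v : Fin ℓ → Fin (n + 2))
    (ε : ℝ) (hv : ∀ b b' : Fin ℓ, b < b' → 0 < ε * galeDet B (v b) (v b')) {y : ℝ}
    (hy : y ∈ galeInterval B) :
    0 < (∏ b, 1 / galeLin B (v b) y) *
      ∏ i : Fin ℓ, ∏ j ∈ Ioi i, ε * galeDet B (v i) (v j) / (galeLin B (v i) y * galeLin B (v j) y) := by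
  apply mul_pos
  · exact Finset.prod_pos fun b _ => one_div_pos.mpr (hy (v b))
  · exact Finset.prod_pos fun i _ => Finset.prod_pos fun j hj =>
      div_pos (hv i j (Finset.mem_Ioi.mp hj)) (mul_pos (hy _) (hy _))

/-- The signed constant of the Wronskian is nonzero ("the sign of the Wronskian only depends on the
number `ℓ` of functions", p0010:L99). [cite: BihanDickenstein2017, Prop. 4.3 (proof)] -/
theorem wronskian_const_ne_zero (ℓ : ℕ) (ε : ℝ) (hε : ε = 1 ∨ ε = -1) :
    (∏ i : Fin ℓ, ((-1 : ℝ) ^ (i : ℕ) * ((i : ℕ).factorial : ℝ))) * ∏ i : Fin ℓ, ∏ _j ∈ Ioi i, ε ≠ 0 := by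
  have hε0 : ε ≠ 0 := by rcases hε with rfl | rfl <;> norm_num
  refine mul_ne_zero (Finset.prod_ne_zero_iff.mpr fun i _ => mul_ne_zero (pow_ne_zero _ (by norm_num))
    (by exact_mod_cast (Nat.factorial_ne_zero i))) ?_
  exact Finset.prod_ne_zero_iff.mpr fun i _ => Finset.prod_ne_zero_iff.mpr fun j _ => hε0

/-- Along the restricted ordering `ᾱ`, the Gale determinants have a STRICT constant sign:
`ε det(P_{ᾱ_r}, P_{ᾱ_{r'}}) > 0` for `r < r'` ("Thus, `det(P_{ᾱ_i}, P_{ᾱ_j}) > 0` for any `i < j` in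
`[k]`, or `< 0` for any `i < j`", p0007:L13). [cite: BihanDickenstein2017, §2.3] -/
theorem galeDet_restrictOrdering_sign (C : Matrix (Fin n) (Fin (n + 2)) ℝ) (hrk : C.rank = n)
    {α : Equiv.Perm (Fin (n + 2))} {K : Finset (Fin (n + 2))} (hK : MinorsNonzeroOn C K)
    {B : Matrix (Fin (n + 2)) (Fin 2) ℝ} (hB : IsGaleDual C B) {ε : ℝ} (hε : ε = 1 ∨ ε = -1)
    (hord : ∀ i j : Fin (n + 2), i < j → 0 ≤ ε * galeDet B (α i) (α j))
    {r r' : Fin K.card} (hrr : r < r') :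
    0 < ε * galeDet B (restrictOrdering α K r) (restrictOrdering α K r') := by
  have hne : restrictOrdering α K r ≠ restrictOrdering α K r' :=
    fun h => hrr.ne (restrictOrdering_injective α K h)
  have hlt : (K.map α.symm.toEmbedding).orderEmbOfFin (Finset.card_map _) r <
      (K.map α.symm.toEmbedding).orderEmbOfFin (Finset.card_map _) r' :=
    (Finset.orderEmbOfFin _ _).strictMono hrr
  have h0 := hord _ _ hlt
  have hgne : galeDet B (restrictOrdering α K r) (restrictOrdering α K r') ≠ 0 := by
    intro h0'
    obtain ⟨δ, hδ, hG⟩ := exists_delta_coeffMinor_eq_galeDet C hrk hB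
    have h := hG _ _ hne
    rw [h0', mul_zero] at h
    have hcm : coeffMinor C (restrictOrdering α K r) (restrictOrdering α K r') ≠ 0 :=
      hK _ (restrictOrdering_mem α K r) _ (restrictOrdering_mem α K r') hne
    have hba : ((restrictOrdering α K r').val : ℝ) - (restrictOrdering α K r).val ≠ 0 := by
      rw [sub_ne_zero]
      exact_mod_cast (Fin.val_ne_of_ne hne).symm
    rcases mul_eq_zero.mp h with h1 | h1
    · rcases mul_eq_zero.mp h1 with h2 | h2
      · exact pow_ne_zero _ (by norm_num) h2
      · exact hcm h2
    · exact hba h1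
  refine lt_of_le_of_ne h0 fun h => hgne ?_
  have hε0 : ε ≠ 0 := by rcases hε with rfl | rfl <;> norm_num
  exact (mul_eq_zero.mp h.symm).resolve_left hε0

end BD17

open BD17

/-! ### Prop. 4.3 from Prop. 4.2 -/

/-- **BD 2017, Prop. 4.3 follows from Prop. 4.2 ([P-S])**: "the collection of nonzero rational
functions `(1/p_{ᾱ_0}, …, 1/p_{ᾱ_{k−1}})` satisfies Descartes' rule of signs on `Δ_P`". Proof as
printed (p0010:L83–L100): check the two Wronskian conditions of Prop. 4.2 — every Wronskian of a
subfamily is `γ_ℓ ∏ p^{-1} ∏_{i<j} det(P_{ᾱ_i}, P_{ᾱ_j})/(p_{ᾱ_i} p_{ᾱ_j})` (`BD17.wronskian_one_div_galeLin`,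
Vandermonde), nonzero with a sign depending only on `ℓ`, since `det(P_{ᾱ_i}, P_{ᾱ_j})` has a strict
constant sign along the restricted ordering (`BD17.galeDet_restrictOrdering_sign`).
[cite: BihanDickenstein2017, Prop. 4.3] -/
theorem BD2017_prop_4_3_of_prop_4_2 (h42 : BD2017_prop_4_2) : BD2017_prop_4_3 := by
  intro n C hrk hcone α hα K hK B hB hΔ
  have hopen := isOpen_galeInterval B
  have hconn : IsConnected (galeInterval B) :=
    ⟨hΔ, (ordConnected_galeInterval B).isPreconnected⟩
  have han : ∀ i : Fin K.card, AnalyticOnNhd ℝ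
      (fun y => 1 / galeLin B (restrictOrdering α K i) y) (galeInterval B) :=
    fun i => analyticOnNhd_one_div_galeLin B _
  obtain ⟨ε, hε, hord⟩ := hα B hB
  have hstrict : ∀ r r' : Fin K.card, r < r' →
      0 < ε * galeDet B (restrictOrdering α K r) (restrictOrdering α K r') :=
    fun r r' hrr => galeDet_restrictOrdering_sign C hrk hK.1 hB hε hord hrr
  have hc := wronskian_const_ne_zero
  refine (h42 K.card _ (galeInterval B) hopen hconn han).mpr ⟨?_, ?_⟩
  · intro ℓ J hJ y hy
    have hv : ∀ b b' : Fin ℓ, b < b' → 0 < ε * galeDet B (restrictOrdering α K (J b))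
        (restrictOrdering α K (J b')) := fun b b' hbb => hstrict _ _ (hJ hbb)
    rw [show (fun b => fun y => 1 / galeLin B (restrictOrdering α K (J b)) y) =
        (fun b => fun y => 1 / galeLin B ((fun b => restrictOrdering α K (J b)) b) y) from rfl,
      wronskian_one_div_galeLin B (fun b => restrictOrdering α K (J b)) ε hε hy]
    exact mul_ne_zero (hc ℓ ε hε) (wronskian_factor_pos B _ ε hv hy).ne'
  · intro ℓ J J' hJ hJ' y hy
    have hv : ∀ b b' : Fin ℓ, b < b' → 0 < ε * galeDet B (restrictOrdering α K (J b))
        (restrictOrdering α K (J b')) := fun b b' hbb => hstrict _ _ (hJ hbb)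
    have hv' : ∀ b b' : Fin ℓ, b < b' → 0 < ε * galeDet B (restrictOrdering α K (J' b))
        (restrictOrdering α K (J' b')) := fun b b' hbb => hstrict _ _ (hJ' hbb)
    rw [show (fun b => fun y => 1 / galeLin B (restrictOrdering α K (J b)) y) =
        (fun b => fun y => 1 / galeLin B ((fun b => restrictOrdering α K (J b)) b) y) from rfl,
      wronskian_one_div_galeLin B (fun b => restrictOrdering α K (J b)) ε hε hy,
      show (fun b => fun y => 1 / galeLin B (restrictOrdering α K (J' b)) y) =
        (fun b => fun y => 1 / galeLin B ((fun b => restrictOrdering α K (J' b)) b) y) from rfl,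
      wronskian_one_div_galeLin B (fun b => restrictOrdering α K (J' b)) ε hε hy]
    have h1 := wronskian_factor_pos B _ ε hv hy
    have h2 := wronskian_factor_pos B _ ε hv' hy
    have h3 : 0 < ((∏ i : Fin ℓ, ((-1 : ℝ) ^ (i : ℕ) * ((i : ℕ).factorial : ℝ))) *
        ∏ i : Fin ℓ, ∏ _j ∈ Ioi i, ε) ^ 2 := by
      have := hc ℓ ε hε
      positivity
    nlinarith [mul_pos h3 (mul_pos h1 h2)]


end Literature.Computability.AlgebraicComplexity
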